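import Literature.MathematicalPhysics.QuantumFieldTheory.Balaban1983to89.B12Membership313II
import Literature.MathematicalPhysics.QuantumFieldTheory.Balaban1983to89.LatticeNorms

/-!
# `Balaban1983to89.B12Ineq332` — [Balaban1987RG1] (3.32) p. 277: the regularity of `A = Λ(𝐀, L⁻¹𝐇_{k+1})` inherited
from (3.31) and (3.27) — all three members (sup norm, lattice gradient, Hölder seminorm of the gradient), PROVED
for the concrete `Λ`

HONEST FRAMING (cell `lit-balaban`, verbatim): statement-level skeleton of published theorems with citation tags; proofs
where landed; nothing here is a claim about the Yang–Mills mass gap.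

CITATION HEADER.  T. Bałaban, *Renormalization group approach to lattice gauge field theories. I. Generation of
effective actions in a small field approximation and a coupling constant renormalization in four dimensions*,
Commun. Math. Phys. **109** (1987) 249–301, doi:10.1007/bf01215223 [Balaban1987RG1] (cell paper B12; held text
`paper:balaban1987-cmp109-rg-i-small-field`, journal page = PDF page + 248; displays read as images from the page renders
`b2b-balaban-ref1/pages/1987-cmp109-rg-I-small-field/…-p027-x2.png` (p. 275), `…-p028-x2.png` (p. 276), `…-p029-x2.png`
(p. 277)).  Unit `lit-balaban-r20` (fold owner of B12), SKELETON row `B12.Eq3.30-3.32` (reader r09: «(3.30)–(3.31)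
typed-existing via the abstract `B12Sec2to5.Lemma4Frame`; (3.32) absent») — this file PROVES the three members of
(3.32) for the concrete bondwise `Λ` of (3.30)/(3.48) (`B12Membership313II.newPot`, BY NAME): §1–§2 (v1, p243581) the sup-norm
and lattice-gradient members, §3 (v1.1) the Hölder member.

WHAT IS PRINTED (verbatim).  p. 275 [PDF 27], (3.27): *«|𝐇_{k+1}(□₀, (1/i) log V)|, |∇^{L⁻¹η}𝐇_{k+1}(□₀, (1/i) log V)|,
‖𝐇_{k+1}(□₀, (1/i) log V)‖_{1,β} < B₃O(1)Mα₀ on □̃⁴, for 0 ≤ β ≤ β₀ < 1»*.  p. 276 [PDF 28], (3.30)–(3.31): *«Let us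
denote A = (1/iη) log exp iη𝐀 exp iL⁻¹η𝐇_{k+1}(□₀, (1/i) log V), B = Q(ηA) on □₀. (3.30) … We assume that 𝐀 is regular
and satisfies the bounds |𝐀|, |∇^η𝐀|, ‖𝐀‖_{1,β} < α₂ on □₀, (3.31) for 0 ≤ β ≤ β₀ < 1. … We have similar bounds for the
function 𝐇_{k+1}(□₀, (1/i) log V), with α₂ replaced by B₃O(1)Mα₀, and □₀ by □̃⁴, see (3.27).»*  p. 277 [PDF 29], (3.32):
*«The assumption (3.31) implies that A satisfies |A|, |∇^ηA|, ‖A‖_{1,β} < 2(α₂ + B₃O(1)Mα₀) on □̃⁴. (3.32) These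
regularity conditions are basic for the further analysis.»*

HOW IT IS FORMALIZED.  Write `α′` for `B₃O(1)Mα₀` and `Λ(𝐀, h) = newPot η 𝐀 h = (iη)⁻¹ log(e^{iη𝐀} e^{iηh})` bondwise
(`h = L⁻¹𝐇_{k+1}(□₀, (1/i) log V)`).  The mechanism behind (3.32) is first order: `Λ(𝐀, h) = 𝐀 + h + (iη)⁻¹G(iη𝐀, iηh)`
with the BCH remainder `G` (`newPot_sub_add`), and `G` is SMALL-Lipschitz — `‖G(X₁,Y₁) − G(X₂,Y₂)‖ ≤ 3(a + a′)(‖X₁ − X₂‖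
+ ‖Y₁ − Y₂‖)` on `‖Xᵢ‖ ≤ a`, `‖Yᵢ‖ ≤ a′`, `a + a′ ≤ 1/8` (`norm_bchRem_sub_bchRem_le`, BY NAME).  Hence (§1, one bond):
`norm_newPot_sub_newPot_le₂` — `Λ` is JOINTLY Lipschitz with constant `1 + 3(a + a′) ≤ 11/8`; `norm_newPot_le_eleven_eighths`
— `‖Λ(𝐀, h)‖ ≤ (11/8)(‖𝐀‖ + ‖h‖)` when `η(‖𝐀‖ + ‖h‖) ≤ 1/8`; and the two printed members at one bond / one pair of bonds:
`ineq332_sup_bond` (`|Λ| < 2(α₂ + α′)`), `ineq332_grad_pair` (a lattice derivative is a scaled difference `c•(F(b′) − F(b))`,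
`c = η⁻¹ ≥ 0`: `|∇^ηΛ| ≤ (11/8)(|∇^η𝐀| + |∇^ηh|) < 2(α₂ + α′)`).  §2 lifts both to the sup norms `LatticeNorms.supNorm` of the
series over a finite bond region `S` (`supNorm_newPot_le`, **`ineq332_sup`**, `supNorm_grad_newPot_le`, **`ineq332_grad`**),
the direction of differentiation being an arbitrary map `sh : ι → ι` (one theorem per lattice direction).  The smallness used
is `η(α₂ + α′) ≤ 1/8` (the print: α's «sufficiently small», `η ≤ 1`); the factor obtained is `11/8`, inside the printed `2`.

WHAT IS NOT PROVED HERE (recorded, not asserted).  v1 of this file recorded the third member `‖A‖_{1,β} < 2(α₂ + α′)`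
(the Hölder seminorm of the lattice GRADIENT, B5 (1.109): `‖A‖_{1,β} = ‖∇A‖_β`, tree `LatticeNorms.holderSeminormB5`) as
«second order» and left it absent; that assessment is WITHDRAWN — §3 (v1.1) proves it by a first-order argument (the gradient
of the BCH remainder carries an extra factor `η`, which the lattice spacing `|x − x′| ≥ η` converts into the Hölder weight
`|x − x′|^β`; see the §3 docstring), under the additional smallness `6(α₂ + α′) ≤ 1` and `0 < η ≤ 1`, `0 ≤ β ≤ 1`.  Nothing
about «on □̃⁴» (the domains) is modelled: all statements are over an arbitrary finite bond / gradient-index set, the lattice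
geometry entering only through the user-supplied shift or endpoint maps, distance function and «same direction» relation.
No `def … : Prop` fact is introduced; every statement below is a theorem proved from Mathlib and the landed modules
`B12Membership313II` / `B12Membership314` / `LatticeNorms` (BY NAME).
-/

namespace Literature.MathematicalPhysics.QuantumFieldTheory.Balaban1983to89.B12Ineq332

open NormedSpace
open Literature.MathematicalPhysics.QuantumFieldTheory.Balaban1983to89
open Literature.MathematicalPhysics.QuantumFieldTheory.Balaban1983to89.B12Membership314 (norm_I_mul_smul)
open Literature.MathematicalPhysics.QuantumFieldTheory.Balaban1983to89.B12Membership313II (bchLog newPot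
  norm_bchRem_sub_bchRem_le newPot_sub_add norm_I_mul_inv_smul norm_newPot_le)
open Literature.MathematicalPhysics.QuantumFieldTheory.Balaban1983to89.LatticeNorms (supNorm norm_le_supNorm supNorm_le
  supNorm_nonneg holderSeminorm holderSeminormB5 holderSeminorm_nonneg holder_bound holderSeminorm_le)
open Complex (I)

/-! ## §1  One bond: `Λ` is jointly Lipschitz with a constant `≤ 11/8`, and the two members of (3.32) -/

section OneBond

variable {𝔸 : Type*} [NormedRing 𝔸] [NormedAlgebra ℂ 𝔸] [CompleteSpace 𝔸]

/-- **Joint Lipschitz bound for `Λ(𝐀, h) = newPot ξ 𝐀 h`**: if `ξ‖A₁‖, ξ‖A₂‖ ≤ a`, `ξ‖A′₁‖, ξ‖A′₂‖ ≤ a′`, `a + a′ ≤ 1/8`,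
then `‖Λ(A₁, A′₁) − Λ(A₂, A′₂)‖ ≤ (1 + 3(a + a′))(‖A₁ − A₂‖ + ‖A′₁ − A′₂‖)` — `Λ = A + A′ + (iξ)⁻¹G(iξA, iξA′)` and the BCH
remainder `G` is `3(a + a′)`-Lipschitz (`norm_bchRem_sub_bchRem_le`, BY NAME).  This is the first-order mechanism of (3.32).
[cite: Balaban1987RG1, (3.32) p.277] (elementary API for the printed implication (3.31) ⇒ (3.32); our proof) -/
theorem norm_newPot_sub_newPot_le₂ {ξ a a' : ℝ} (hξ : 0 < ξ) {A₁ A₂ A'₁ A'₂ : 𝔸} (h₁ : ξ * ‖A₁‖ ≤ a)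
    (h₂ : ξ * ‖A₂‖ ≤ a) (h₁' : ξ * ‖A'₁‖ ≤ a') (h₂' : ξ * ‖A'₂‖ ≤ a') (hr : a + a' ≤ 1 / 8) :
    ‖newPot ξ A₁ A'₁ - newPot ξ A₂ A'₂‖ ≤ (1 + 3 * (a + a')) * (‖A₁ - A₂‖ + ‖A'₁ - A'₂‖) := by
  set G₁ := bchLog ((I * ξ : ℂ) • A₁) ((I * ξ : ℂ) • A'₁) - ((I * ξ : ℂ) • A₁ + (I * ξ : ℂ) • A'₁) with hG₁
  set G₂ := bchLog ((I * ξ : ℂ) • A₂) ((I * ξ : ℂ) • A'₂) - ((I * ξ : ℂ) • A₂ + (I * ξ : ℂ) • A'₂) with hG₂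
  have hG : ‖G₁ - G₂‖ ≤
      3 * (a + a') * (‖(I * ξ : ℂ) • A₁ - (I * ξ : ℂ) • A₂‖ + ‖(I * ξ : ℂ) • A'₁ - (I * ξ : ℂ) • A'₂‖) :=
    norm_bchRem_sub_bchRem_le (by rwa [norm_I_mul_smul hξ.le]) (by rwa [norm_I_mul_smul hξ.le])
      (by rwa [norm_I_mul_smul hξ.le]) (by rwa [norm_I_mul_smul hξ.le]) hr
  rw [← smul_sub, ← smul_sub, norm_I_mul_smul hξ.le, norm_I_mul_smul hξ.le] at hG
  have hsplit : newPot ξ A₁ A'₁ - newPot ξ A₂ A'₂ = ((A₁ - A₂) + (A'₁ - A'₂)) + (I * ξ : ℂ)⁻¹ • (G₁ - G₂) := by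
    have e1 := newPot_sub_add hξ.ne' A₁ A'₁
    have e2 := newPot_sub_add hξ.ne' A₂ A'₂
    rw [← hG₁] at e1
    rw [← hG₂] at e2
    rw [smul_sub, ← e1, ← e2]
    abel
  rw [hsplit]
  calc ‖(A₁ - A₂) + (A'₁ - A'₂) + (I * ξ : ℂ)⁻¹ • (G₁ - G₂)‖
      ≤ ‖(A₁ - A₂) + (A'₁ - A'₂)‖ + ‖(I * ξ : ℂ)⁻¹ • (G₁ - G₂)‖ := norm_add_le _ _
    _ ≤ (‖A₁ - A₂‖ + ‖A'₁ - A'₂‖) + ξ⁻¹ * ‖G₁ - G₂‖ := by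
        rw [norm_I_mul_inv_smul hξ]
        exact add_le_add (norm_add_le (A₁ - A₂) (A'₁ - A'₂)) le_rfl
    _ ≤ (‖A₁ - A₂‖ + ‖A'₁ - A'₂‖) + ξ⁻¹ * (3 * (a + a') * (ξ * ‖A₁ - A₂‖ + ξ * ‖A'₁ - A'₂‖)) := by gcongr
    _ = (1 + 3 * (a + a')) * (‖A₁ - A₂‖ + ‖A'₁ - A'₂‖) := by
        rw [show ξ * ‖A₁ - A₂‖ + ξ * ‖A'₁ - A'₂‖ = ξ * (‖A₁ - A₂‖ + ‖A'₁ - A'₂‖) by ring,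
          mul_left_comm (3 * (a + a')) ξ, inv_mul_cancel_left₀ hξ.ne']
        ring

/-- **Size of `Λ`**: `‖Λ(A, A′)‖ ≤ (11/8)(‖A‖ + ‖A′‖)` when `ξ(‖A‖ + ‖A′‖) ≤ 1/8` (`ξ > 0`) — from the tree's
`norm_newPot_le` (`‖Λ‖ ≤ ‖A‖ + ‖A′‖ + 3ξ(‖A‖ + ‖A′‖)²`, BY NAME). [cite: Balaban1987RG1, (3.32) p.277]
(elementary API for the first member of (3.32); our proof) -/
theorem norm_newPot_le_eleven_eighths {ξ : ℝ} (hξ : 0 < ξ) {A A' : 𝔸} (h : ξ * (‖A‖ + ‖A'‖) ≤ 1 / 8) :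
    ‖newPot ξ A A'‖ ≤ 11 / 8 * (‖A‖ + ‖A'‖) := by
  have h1 := norm_newPot_le hξ h
  have hs : 0 ≤ ‖A‖ + ‖A'‖ := by positivity
  have h2 : 3 * ξ * (‖A‖ + ‖A'‖) ^ 2 ≤ 3 / 8 * (‖A‖ + ‖A'‖) := by
    nlinarith [mul_le_mul_of_nonneg_left h hs]
  linarith

/-- **(3.32), first member, at one bond**: if `|𝐀(b)| < α₂` ((3.31)), `|h(b)| < α′` ((3.27), `α′ = B₃O(1)Mα₀`) and
`η(α₂ + α′) ≤ 1/8`, then `|A(b)| = |Λ(𝐀(b), h(b))| < 2(α₂ + α′)`. [cite: Balaban1987RG1, (3.32) p.277] -/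
theorem ineq332_sup_bond {η α₂ α' : ℝ} (hη : 0 < η) {A h : 𝔸} (hA : ‖A‖ < α₂) (hh : ‖h‖ < α')
    (hsmall : η * (α₂ + α') ≤ 1 / 8) : ‖newPot η A h‖ < 2 * (α₂ + α') := by
  have hs : η * (‖A‖ + ‖h‖) ≤ 1 / 8 :=
    (mul_le_mul_of_nonneg_left (by linarith) hη.le).trans hsmall
  have h1 := norm_newPot_le_eleven_eighths hη hs
  have h0 : 0 ≤ ‖A‖ := norm_nonneg _
  have h0' : 0 ≤ ‖h‖ := norm_nonneg _
  linarith

/-- **(3.32), second member, at one pair of bonds**: a lattice derivative is a scaled difference `c•(F(b′) − F(b))`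
(`c = η⁻¹ ≥ 0`).  If `|𝐀| < α₂`, `|h| < α′` at both bonds, `|c•(𝐀(b′) − 𝐀(b))| < α₂`, `|c•(h(b′) − h(b))| < α′`, and
`η(α₂ + α′) ≤ 1/8`, then `|c•(A(b′) − A(b))| ≤ (11/8)(|c•(𝐀(b′) − 𝐀(b))| + |c•(h(b′) − h(b))|) < 2(α₂ + α′)` for
`A = Λ(𝐀, h)` bondwise. [cite: Balaban1987RG1, (3.32) p.277] -/
theorem ineq332_grad_pair {η c α₂ α' : ℝ} (hη : 0 < η) (hc : 0 ≤ c) {A₁ A₂ h₁ h₂ : 𝔸}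
    (hA₁ : ‖A₁‖ < α₂) (hA₂ : ‖A₂‖ < α₂) (hh₁ : ‖h₁‖ < α') (hh₂ : ‖h₂‖ < α')
    (hdA : ‖c • (A₁ - A₂)‖ < α₂) (hdh : ‖c • (h₁ - h₂)‖ < α') (hsmall : η * (α₂ + α') ≤ 1 / 8) :
    ‖c • (newPot η A₁ h₁ - newPot η A₂ h₂)‖ ≤ 11 / 8 * (‖c • (A₁ - A₂)‖ + ‖c • (h₁ - h₂)‖) ∧
      ‖c • (newPot η A₁ h₁ - newPot η A₂ h₂)‖ < 2 * (α₂ + α') := by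
  have hL := norm_newPot_sub_newPot_le₂ hη (a := η * α₂) (a' := η * α') (A₁ := A₁) (A₂ := A₂) (A'₁ := h₁)
    (A'₂ := h₂) (mul_le_mul_of_nonneg_left hA₁.le hη.le) (mul_le_mul_of_nonneg_left hA₂.le hη.le)
    (mul_le_mul_of_nonneg_left hh₁.le hη.le) (mul_le_mul_of_nonneg_left hh₂.le hη.le) (by linarith)
  have hK : 1 + 3 * (η * α₂ + η * α') ≤ 11 / 8 := by linarith
  have hcn : ∀ x : 𝔸, ‖c • x‖ = c * ‖x‖ := fun x => by rw [norm_smul, Real.norm_eq_abs, abs_of_nonneg hc]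
  have h1 : ‖c • (newPot η A₁ h₁ - newPot η A₂ h₂)‖ ≤ 11 / 8 * (‖c • (A₁ - A₂)‖ + ‖c • (h₁ - h₂)‖) := by
    rw [hcn, hcn, hcn]
    have hn : 0 ≤ ‖A₁ - A₂‖ + ‖h₁ - h₂‖ := by positivity
    calc c * ‖newPot η A₁ h₁ - newPot η A₂ h₂‖
        ≤ c * ((1 + 3 * (η * α₂ + η * α')) * (‖A₁ - A₂‖ + ‖h₁ - h₂‖)) := mul_le_mul_of_nonneg_left hL hc
      _ ≤ c * (11 / 8 * (‖A₁ - A₂‖ + ‖h₁ - h₂‖)) :=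
          mul_le_mul_of_nonneg_left (mul_le_mul_of_nonneg_right hK hn) hc
      _ = 11 / 8 * (c * ‖A₁ - A₂‖ + c * ‖h₁ - h₂‖) := by ring
  refine ⟨h1, h1.trans_lt ?_⟩
  have h0 : 0 ≤ ‖c • (A₁ - A₂)‖ := norm_nonneg _
  have h0' : 0 ≤ ‖c • (h₁ - h₂)‖ := norm_nonneg _
  linarith

end OneBond

/-! ## §2  Field level: the sup norms of the series (`LatticeNorms.supNorm`) over a finite bond region -/

section FieldLevel

variable {ι : Type*} {𝔸 : Type*} [NormedRing 𝔸] [NormedAlgebra ℂ 𝔸] [CompleteSpace 𝔸]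

/-- `|A| ≤ (11/8)(|𝐀| + |h|)` in the sup norms over a finite bond region `S`, for `A = Λ(𝐀, h)` bondwise, when
`η(|𝐀| + |h|) ≤ 1/8`. [cite: Balaban1987RG1, (3.32) p.277] (elementary API for the first member; our proof) -/
theorem supNorm_newPot_le {η : ℝ} (hη : 0 < η) (S : Finset ι) (A h : ι → 𝔸)
    (hsmall : η * (supNorm S A + supNorm S h) ≤ 1 / 8) :
    supNorm S (fun b => newPot η (A b) (h b)) ≤ 11 / 8 * (supNorm S A + supNorm S h) := by
  have hN0 : 0 ≤ supNorm S A := supNorm_nonneg S A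
  have hN0' : 0 ≤ supNorm S h := supNorm_nonneg S h
  refine supNorm_le (by positivity) fun b hb => ?_
  have h1 : ‖A b‖ ≤ supNorm S A := norm_le_supNorm A hb
  have h2 : ‖h b‖ ≤ supNorm S h := norm_le_supNorm h hb
  have hs : η * (‖A b‖ + ‖h b‖) ≤ 1 / 8 := (mul_le_mul_of_nonneg_left (add_le_add h1 h2) hη.le).trans hsmall
  calc ‖newPot η (A b) (h b)‖ ≤ 11 / 8 * (‖A b‖ + ‖h b‖) := norm_newPot_le_eleven_eighths hη hs
    _ ≤ 11 / 8 * (supNorm S A + supNorm S h) := by linarith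

/-- **(3.32), first member** («|A| < 2(α₂ + B₃O(1)Mα₀)»): if `|𝐀| < α₂` ((3.31)) and `|h| < α′` ((3.27)) in the sup norms
over the finite bond region `S`, and `η(α₂ + α′) ≤ 1/8`, then `|A| < 2(α₂ + α′)` for `A = Λ(𝐀, h)` bondwise.
[cite: Balaban1987RG1, (3.32) p.277] -/
theorem ineq332_sup {η α₂ α' : ℝ} (hη : 0 < η) (S : Finset ι) {A h : ι → 𝔸} (hA : supNorm S A < α₂)
    (hh : supNorm S h < α') (hsmall : η * (α₂ + α') ≤ 1 / 8) :
    supNorm S (fun b => newPot η (A b) (h b)) < 2 * (α₂ + α') := by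
  have hs : η * (supNorm S A + supNorm S h) ≤ 1 / 8 :=
    (mul_le_mul_of_nonneg_left (by linarith) hη.le).trans hsmall
  have h1 := supNorm_newPot_le hη S A h hs
  have hN0 : 0 ≤ supNorm S A := supNorm_nonneg S A
  have hN0' : 0 ≤ supNorm S h := supNorm_nonneg S h
  linarith

/-- `|∇A| ≤ (11/8)(|∇𝐀| + |∇h|)` in the sup norms over a finite bond region `S`, for `A = Λ(𝐀, h)` bondwise and the lattice
derivative `(∇F)(b) = c•(F(sh b) − F(b))` along an arbitrary shift `sh : ι → ι` with scale `c ≥ 0` (`c = η⁻¹`, `sh b = b +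
ηe_ν`), when `|𝐀|, |h|` are bounded by `m`, `m′` on `S` and on `sh(S)` with `η(m + m′) ≤ 1/8`.
[cite: Balaban1987RG1, (3.32) p.277] (elementary API for the second member; our proof) -/
theorem supNorm_grad_newPot_le {η c m m' : ℝ} (hη : 0 < η) (hc : 0 ≤ c) (S : Finset ι) (sh : ι → ι) (A h : ι → 𝔸)
    (hA : ∀ b ∈ S, ‖A b‖ ≤ m ∧ ‖A (sh b)‖ ≤ m) (hh : ∀ b ∈ S, ‖h b‖ ≤ m' ∧ ‖h (sh b)‖ ≤ m')
    (hsmall : η * (m + m') ≤ 1 / 8) :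
    supNorm S (fun b => c • (newPot η (A (sh b)) (h (sh b)) - newPot η (A b) (h b))) ≤
      11 / 8 * (supNorm S (fun b => c • (A (sh b) - A b)) + supNorm S (fun b => c • (h (sh b) - h b))) := by
  have hN0 := supNorm_nonneg S (fun b => c • (A (sh b) - A b))
  have hN0' := supNorm_nonneg S (fun b => c • (h (sh b) - h b))
  refine supNorm_le (by positivity) fun b hb => ?_
  obtain ⟨hA1, hA2⟩ := hA b hb
  obtain ⟨hh1, hh2⟩ := hh b hb
  have hL := norm_newPot_sub_newPot_le₂ hη (a := η * m) (a' := η * m') (A₁ := A (sh b)) (A₂ := A b)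
    (A'₁ := h (sh b)) (A'₂ := h b) (mul_le_mul_of_nonneg_left hA2 hη.le) (mul_le_mul_of_nonneg_left hA1 hη.le)
    (mul_le_mul_of_nonneg_left hh2 hη.le) (mul_le_mul_of_nonneg_left hh1 hη.le) (by linarith)
  have hK : 1 + 3 * (η * m + η * m') ≤ 11 / 8 := by linarith
  have hcn : ∀ x : 𝔸, ‖c • x‖ = c * ‖x‖ := fun x => by rw [norm_smul, Real.norm_eq_abs, abs_of_nonneg hc]
  have hn : 0 ≤ ‖A (sh b) - A b‖ + ‖h (sh b) - h b‖ := by positivity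
  have g1 : ‖c • (A (sh b) - A b)‖ ≤ supNorm S (fun b => c • (A (sh b) - A b)) :=
    norm_le_supNorm (fun b => c • (A (sh b) - A b)) hb
  have g2 : ‖c • (h (sh b) - h b)‖ ≤ supNorm S (fun b => c • (h (sh b) - h b)) :=
    norm_le_supNorm (fun b => c • (h (sh b) - h b)) hb
  rw [hcn] at g1 g2 ⊢
  calc c * ‖newPot η (A (sh b)) (h (sh b)) - newPot η (A b) (h b)‖
      ≤ c * ((1 + 3 * (η * m + η * m')) * (‖A (sh b) - A b‖ + ‖h (sh b) - h b‖)) := mul_le_mul_of_nonneg_left hL hc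
    _ ≤ c * (11 / 8 * (‖A (sh b) - A b‖ + ‖h (sh b) - h b‖)) :=
        mul_le_mul_of_nonneg_left (mul_le_mul_of_nonneg_right hK hn) hc
    _ = 11 / 8 * (c * ‖A (sh b) - A b‖ + c * ‖h (sh b) - h b‖) := by ring
    _ ≤ 11 / 8 * (supNorm S (fun b => c • (A (sh b) - A b)) + supNorm S (fun b => c • (h (sh b) - h b))) := by
        linarith

/-- **(3.32), second member** («|∇^ηA| < 2(α₂ + B₃O(1)Mα₀)»), one lattice direction: with `(∇F)(b) = c•(F(sh b) − F(b))`
(`c = η⁻¹ ≥ 0`, `sh` the shift by `ηe_ν`), if `|𝐀| < α₂`, `|∇𝐀| < α₂` ((3.31)) and `|h| < α′`, `|∇h| < α′` ((3.27)) on the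
region (values of `𝐀`, `h` bounded on `S` and `sh(S)`), and `η(α₂ + α′) ≤ 1/8`, then `|∇A| < 2(α₂ + α′)` in the sup norm over
`S`, for `A = Λ(𝐀, h)` bondwise. [cite: Balaban1987RG1, (3.32) p.277] -/
theorem ineq332_grad {η c α₂ α' : ℝ} (hη : 0 < η) (hc : 0 ≤ c) (S : Finset ι) (sh : ι → ι) {A h : ι → 𝔸}
    (hA : ∀ b ∈ S, ‖A b‖ < α₂ ∧ ‖A (sh b)‖ < α₂) (hh : ∀ b ∈ S, ‖h b‖ < α' ∧ ‖h (sh b)‖ < α')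
    (hdA : supNorm S (fun b => c • (A (sh b) - A b)) < α₂) (hdh : supNorm S (fun b => c • (h (sh b) - h b)) < α')
    (hsmall : η * (α₂ + α') ≤ 1 / 8) :
    supNorm S (fun b => c • (newPot η (A (sh b)) (h (sh b)) - newPot η (A b) (h b))) < 2 * (α₂ + α') := by
  have h1 := supNorm_grad_newPot_le hη hc S sh A h (m := α₂) (m' := α')
    (fun b hb => ⟨(hA b hb).1.le, (hA b hb).2.le⟩) (fun b hb => ⟨(hh b hb).1.le, (hh b hb).2.le⟩) hsmall
  have hN0 := supNorm_nonneg S (fun b => c • (A (sh b) - A b))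
  have hN0' := supNorm_nonneg S (fun b => c • (h (sh b) - h b))
  linarith

end FieldLevel

/-! ## §3  The Hölder member of (3.32): `‖A‖_{1,β} = ‖∇^ηA‖_β` (B5 (1.109), tree `LatticeNorms.holderSeminormB5`)

The mechanism is again FIRST order.  Write `∇F(k) = c•(F(tgt k) − F(src k))` for the lattice gradient, indexed by an
arbitrary type `κ` of «(direction, bond)» pairs with endpoint maps `src tgt : κ → ι` (this subsumes the one-direction form
of §2: `κ = ι`, `src = id`, `tgt = sh`).  Bondwise `Λ(𝐀, h) = 𝐀 + h + r` with the BCH remainder `r = (iη)⁻¹G(iη𝐀, iηh)`, so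
`∇Λ = ∇𝐀 + ∇h + ∇r`, and `∇r` is SMALL outright: `|∇r(k)| ≤ 3η(m + m′)(|∇𝐀(k)| + |∇h(k)|)` when `|𝐀| ≤ m`, `|h| ≤ m′`,
`η(m + m′) ≤ 1/8` (`norm_grad_newPotRem_le`, from `norm_bchRem_sub_bchRem_le` BY NAME).  A Hölder quotient of `∇r` over a
pair `k, k′` at distance `0 < |x − x′| ≤ 1` is then bounded crudely by `(|∇r(k)| + |∇r(k′)|)/|x − x′|^β ≤ 6η(m + m′)(g + g′)
/|x − x′|^β`, and on the `η`-lattice distinct points are at distance `≥ η` (hypothesis `hsep`), so `|x − x′|^β ≥ η^β ≥ η` for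
`0 < η ≤ 1`, `0 ≤ β ≤ 1`: the quotient is `≤ 6(m + m′)(g + g′)`.  Hence (`holder_pair_grad_newPot_le`, `holderB5_grad_newPot_le`)
`‖Λ(𝐀,h)‖_{1,β} ≤ ‖𝐀‖_{1,β} + ‖h‖_{1,β} + 6(m + m′)(g + g′)`, and with `m = g = α₂`, `m′ = g′ = α′` ((3.31), (3.27)) the printed
third member **`ineq332_holder`**: `‖A‖_{1,β} < α₂ + α′ + 6(α₂ + α′)² ≤ 2(α₂ + α′)` as soon as `6(α₂ + α′) ≤ 1` (α's
«sufficiently small», as everywhere in [I]).  The B5 (1.109) admissibility `|x − x′| ≤ 1`, same vector index, is that of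
`LatticeNorms.holderSeminormB5` (BY NAME); the distance function and the «same direction» relation on `κ` are parameters. -/

section HolderMember

variable {𝔸 : Type*} [NormedRing 𝔸] [NormedAlgebra ℂ 𝔸] [CompleteSpace 𝔸]

/-- **The BCH-remainder part of `Λ` is small-Lipschitz** (one pair of bonds): with `Λ(A, A′) − (A + A′) = (iξ)⁻¹G(iξA, iξA′)`
(`newPot_sub_add`), if `ξ‖Aᵢ‖ ≤ a`, `ξ‖A′ᵢ‖ ≤ a′` (`i = 1, 2`) and `a + a′ ≤ 1/8`, then
`‖(Λ(A₁,A′₁) − Λ(A₂,A′₂)) − ((A₁ − A₂) + (A′₁ − A′₂))‖ ≤ 3(a + a′)(‖A₁ − A₂‖ + ‖A′₁ − A′₂‖)` — the remainder `G` is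
`3(a + a′)`-Lipschitz (`norm_bchRem_sub_bchRem_le`, BY NAME) and the factor `ξ⁻¹` cancels against the scaling `iξ•` of its
arguments. [cite: Balaban1987RG1, (3.32) p.277] (elementary API for the third member of (3.32); our proof) -/
theorem norm_newPot_sub_newPot_sub_lin_le {ξ a a' : ℝ} (hξ : 0 < ξ) {A₁ A₂ A'₁ A'₂ : 𝔸} (h₁ : ξ * ‖A₁‖ ≤ a)
    (h₂ : ξ * ‖A₂‖ ≤ a) (h₁' : ξ * ‖A'₁‖ ≤ a') (h₂' : ξ * ‖A'₂‖ ≤ a') (hr : a + a' ≤ 1 / 8) :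
    ‖newPot ξ A₁ A'₁ - newPot ξ A₂ A'₂ - ((A₁ - A₂) + (A'₁ - A'₂))‖ ≤
      3 * (a + a') * (‖A₁ - A₂‖ + ‖A'₁ - A'₂‖) := by
  set G₁ := bchLog ((I * ξ : ℂ) • A₁) ((I * ξ : ℂ) • A'₁) - ((I * ξ : ℂ) • A₁ + (I * ξ : ℂ) • A'₁) with hG₁
  set G₂ := bchLog ((I * ξ : ℂ) • A₂) ((I * ξ : ℂ) • A'₂) - ((I * ξ : ℂ) • A₂ + (I * ξ : ℂ) • A'₂) with hG₂
  have hG : ‖G₁ - G₂‖ ≤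
      3 * (a + a') * (‖(I * ξ : ℂ) • A₁ - (I * ξ : ℂ) • A₂‖ + ‖(I * ξ : ℂ) • A'₁ - (I * ξ : ℂ) • A'₂‖) :=
    norm_bchRem_sub_bchRem_le (by rwa [norm_I_mul_smul hξ.le]) (by rwa [norm_I_mul_smul hξ.le])
      (by rwa [norm_I_mul_smul hξ.le]) (by rwa [norm_I_mul_smul hξ.le]) hr
  rw [← smul_sub, ← smul_sub, norm_I_mul_smul hξ.le, norm_I_mul_smul hξ.le] at hG
  have hsplit : newPot ξ A₁ A'₁ - newPot ξ A₂ A'₂ - ((A₁ - A₂) + (A'₁ - A'₂)) = (I * ξ : ℂ)⁻¹ • (G₁ - G₂) := by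
    have e1 := newPot_sub_add hξ.ne' A₁ A'₁
    have e2 := newPot_sub_add hξ.ne' A₂ A'₂
    rw [← hG₁] at e1
    rw [← hG₂] at e2
    rw [smul_sub, ← e1, ← e2]
    abel
  rw [hsplit, norm_I_mul_inv_smul hξ]
  calc ξ⁻¹ * ‖G₁ - G₂‖ ≤ ξ⁻¹ * (3 * (a + a') * (ξ * ‖A₁ - A₂‖ + ξ * ‖A'₁ - A'₂‖)) := by gcongr
    _ = 3 * (a + a') * (‖A₁ - A₂‖ + ‖A'₁ - A'₂‖) := by
        rw [show ξ * ‖A₁ - A₂‖ + ξ * ‖A'₁ - A'₂‖ = ξ * (‖A₁ - A₂‖ + ‖A'₁ - A'₂‖) by ring,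
          mul_left_comm (3 * (a + a')) ξ, inv_mul_cancel_left₀ hξ.ne']

/-- **The gradient of the BCH remainder is small**: for a lattice derivative written as a scaled difference (`c ≥ 0`), if
`|𝐀| ≤ m` and `|h| ≤ m′` at both bonds and `η(m + m′) ≤ 1/8`, then
`‖∇Λ(𝐀,h) − (∇𝐀 + ∇h)‖ ≤ 3η(m + m′)(‖∇𝐀‖ + ‖∇h‖)` at that pair of bonds — a factor `η` better than the gradients themselves.
[cite: Balaban1987RG1, (3.32) p.277] (elementary API for the third member of (3.32); our proof) -/
theorem norm_grad_newPotRem_le {η c m m' : ℝ} (hη : 0 < η) (hc : 0 ≤ c) {A₁ A₂ h₁ h₂ : 𝔸}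
    (hA₁ : ‖A₁‖ ≤ m) (hA₂ : ‖A₂‖ ≤ m) (hh₁ : ‖h₁‖ ≤ m') (hh₂ : ‖h₂‖ ≤ m') (hsmall : η * (m + m') ≤ 1 / 8) :
    ‖c • (newPot η A₁ h₁ - newPot η A₂ h₂) - (c • (A₁ - A₂) + c • (h₁ - h₂))‖ ≤
      3 * η * (m + m') * (‖c • (A₁ - A₂)‖ + ‖c • (h₁ - h₂)‖) := by
  have hL := norm_newPot_sub_newPot_sub_lin_le hη (a := η * m) (a' := η * m') (A₁ := A₁) (A₂ := A₂) (A'₁ := h₁)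
    (A'₂ := h₂) (mul_le_mul_of_nonneg_left hA₁ hη.le) (mul_le_mul_of_nonneg_left hA₂ hη.le)
    (mul_le_mul_of_nonneg_left hh₁ hη.le) (mul_le_mul_of_nonneg_left hh₂ hη.le) (by linarith)
  have hcn : ∀ x : 𝔸, ‖c • x‖ = c * ‖x‖ := fun x => by rw [norm_smul, Real.norm_eq_abs, abs_of_nonneg hc]
  rw [← smul_add, ← smul_sub, hcn, hcn, hcn]
  calc c * ‖newPot η A₁ h₁ - newPot η A₂ h₂ - (A₁ - A₂ + (h₁ - h₂))‖
      ≤ c * (3 * (η * m + η * m') * (‖A₁ - A₂‖ + ‖h₁ - h₂‖)) := mul_le_mul_of_nonneg_left hL hc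
    _ = 3 * η * (m + m') * (c * ‖A₁ - A₂‖ + c * ‖h₁ - h₂‖) := by ring

variable {ι κ : Type*}

/-- **One Hölder quotient of `∇Λ(𝐀, h)`**: for gradient indices `k, k′ ∈ S` with the same direction, `0 < |x − x′| ≤ 1` and
`|x − x′| ≥ η` (lattice spacing; `0 < η ≤ 1`, `0 ≤ β ≤ 1`), if `|𝐀| ≤ m`, `|h| ≤ m′`, `|∇𝐀| ≤ g`, `|∇h| ≤ g′` on `S` and
`η(m + m′) ≤ 1/8`, then `|∇Λ(k′) − ∇Λ(k)| ≤ (‖∇𝐀‖_β + ‖∇h‖_β + 6(m + m′)(g + g′))·|x − x′|^β`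
(`∇Λ = ∇𝐀 + ∇h + ∇r`, the two Hölder bounds `LatticeNorms.holder_bound` BY NAME, and `2·3η(m + m′)(g + g′) ≤
6(m + m′)(g + g′)|x − x′|^β` because `η ≤ η^β ≤ |x − x′|^β`). [cite: Balaban1987RG1, (3.32) p.277]
(elementary API for the third member of (3.32); our proof) -/
theorem holder_pair_grad_newPot_le {η c m m' g g' β : ℝ} (hη : 0 < η) (hη1 : η ≤ 1) (hβ0 : 0 ≤ β) (hβ1 : β ≤ 1)
    (hc : 0 ≤ c) (sameDir : κ → κ → Prop) (dist : κ → κ → ℝ) (S : Finset κ) (src tgt : κ → ι) (A h : ι → 𝔸)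
    (hA : ∀ k ∈ S, ‖A (src k)‖ ≤ m ∧ ‖A (tgt k)‖ ≤ m) (hh : ∀ k ∈ S, ‖h (src k)‖ ≤ m' ∧ ‖h (tgt k)‖ ≤ m')
    (hgA : ∀ k ∈ S, ‖c • (A (tgt k) - A (src k))‖ ≤ g) (hgh : ∀ k ∈ S, ‖c • (h (tgt k) - h (src k))‖ ≤ g')
    (hsmall : η * (m + m') ≤ 1 / 8) {k k' : κ} (hk : k ∈ S) (hk' : k' ∈ S) (hdir : sameDir k k')
    (hle1 : dist k k' ≤ 1) (hpos : 0 < dist k k') (hsep : η ≤ dist k k') :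
    ‖c • (newPot η (A (tgt k')) (h (tgt k')) - newPot η (A (src k')) (h (src k'))) -
        c • (newPot η (A (tgt k)) (h (tgt k)) - newPot η (A (src k)) (h (src k)))‖ ≤
      (holderSeminormB5 β sameDir dist S (fun k => c • (A (tgt k) - A (src k))) +
          holderSeminormB5 β sameDir dist S (fun k => c • (h (tgt k) - h (src k))) +
          6 * (m + m') * (g + g')) * dist k k' ^ β := by
  set dA : κ → 𝔸 := fun k => c • (A (tgt k) - A (src k)) with hdA
  set dh : κ → 𝔸 := fun k => c • (h (tgt k) - h (src k)) with hdh
  set HA := holderSeminormB5 β sameDir dist S dA with hHAdef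
  set Hh := holderSeminormB5 β sameDir dist S dh with hHhdef
  set δ := dist k k' with hδ
  -- the two printed Hölder bounds, BY NAME
  have hHA : ‖dA k' - dA k‖ ≤ HA * δ ^ β :=
    holder_bound (α := β) (adm := fun b b' => sameDir b b' ∧ dist b b' ≤ 1) (dist := dist) (τ := fun _ _ => id)
      (S := S) dA hk hk' ⟨hdir, hle1⟩ hpos
  have hHh : ‖dh k' - dh k‖ ≤ Hh * δ ^ β :=
    holder_bound (α := β) (adm := fun b b' => sameDir b b' ∧ dist b b' ≤ 1) (dist := dist) (τ := fun _ _ => id)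
      (S := S) dh hk hk' ⟨hdir, hle1⟩ hpos
  -- signs
  have hm : 0 ≤ m := (norm_nonneg _).trans (hA k hk).1
  have hm' : 0 ≤ m' := (norm_nonneg _).trans (hh k hk).1
  have hg : 0 ≤ g := (norm_nonneg _).trans (hgA k hk)
  have hg' : 0 ≤ g' := (norm_nonneg _).trans (hgh k hk)
  have h3 : 0 ≤ 3 * η * (m + m') := mul_nonneg (by positivity) (add_nonneg hm hm')
  have hP : 0 ≤ 6 * (m + m') * (g + g') := mul_nonneg (mul_nonneg (by norm_num) (add_nonneg hm hm')) (add_nonneg hg hg')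
  -- the remainder gradients are small at `k` and at `k'`
  have hR : ∀ j ∈ S, ‖c • (newPot η (A (tgt j)) (h (tgt j)) - newPot η (A (src j)) (h (src j))) - (dA j + dh j)‖ ≤
      3 * η * (m + m') * (g + g') := by
    intro j hj
    have h1 := norm_grad_newPotRem_le hη hc (hA j hj).2 (hA j hj).1 (hh j hj).2 (hh j hj).1 hsmall
    calc ‖c • (newPot η (A (tgt j)) (h (tgt j)) - newPot η (A (src j)) (h (src j))) - (dA j + dh j)‖
        ≤ 3 * η * (m + m') * (‖dA j‖ + ‖dh j‖) := h1
      _ ≤ 3 * η * (m + m') * (g + g') := mul_le_mul_of_nonneg_left (add_le_add (hgA j hj) (hgh j hj)) h3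
  -- lattice spacing: `η ≤ η^β ≤ δ^β`
  have hηδ : η ≤ δ ^ β :=
    calc η = η ^ (1 : ℝ) := (Real.rpow_one η).symm
      _ ≤ η ^ β := Real.rpow_le_rpow_of_exponent_ge hη hη1 hβ1
      _ ≤ δ ^ β := Real.rpow_le_rpow hη.le hsep hβ0
  -- assemble
  set Λ₁ := c • (newPot η (A (tgt k')) (h (tgt k')) - newPot η (A (src k')) (h (src k'))) with hΛ₁
  set Λ₀ := c • (newPot η (A (tgt k)) (h (tgt k)) - newPot η (A (src k)) (h (src k))) with hΛ₀
  have hdec : Λ₁ - Λ₀ = (dA k' - dA k) + (dh k' - dh k) + ((Λ₁ - (dA k' + dh k')) - (Λ₀ - (dA k + dh k))) := by abel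
  rw [hdec]
  calc ‖(dA k' - dA k) + (dh k' - dh k) + ((Λ₁ - (dA k' + dh k')) - (Λ₀ - (dA k + dh k)))‖
      ≤ ‖dA k' - dA k‖ + ‖dh k' - dh k‖ + ‖(Λ₁ - (dA k' + dh k')) - (Λ₀ - (dA k + dh k))‖ := norm_add₃_le
    _ ≤ ‖dA k' - dA k‖ + ‖dh k' - dh k‖ + (‖Λ₁ - (dA k' + dh k')‖ + ‖Λ₀ - (dA k + dh k)‖) :=
        add_le_add le_rfl (norm_sub_le _ _)
    _ ≤ HA * δ ^ β + Hh * δ ^ β + (3 * η * (m + m') * (g + g') + 3 * η * (m + m') * (g + g')) :=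
        add_le_add (add_le_add hHA hHh) (add_le_add (hR k' hk') (hR k hk))
    _ = HA * δ ^ β + Hh * δ ^ β + 6 * (m + m') * (g + g') * η := by ring
    _ ≤ HA * δ ^ β + Hh * δ ^ β + 6 * (m + m') * (g + g') * δ ^ β :=
        add_le_add le_rfl (mul_le_mul_of_nonneg_left hηδ hP)
    _ = (HA + Hh + 6 * (m + m') * (g + g')) * δ ^ β := by ring

/-- **`‖Λ(𝐀, h)‖_{1,β} ≤ ‖𝐀‖_{1,β} + ‖h‖_{1,β} + 6(m + m′)(g + g′)`** — the Hölder seminorm (B5 (1.109),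
`LatticeNorms.holderSeminormB5`: pairs with the same direction at distance `0 < |x − x′| ≤ 1`) of the lattice gradient of
`A = Λ(𝐀, h)` bondwise over a finite index region `S`, under `|𝐀| ≤ m`, `|h| ≤ m′`, `|∇𝐀| ≤ g`, `|∇h| ≤ g′` on `S`,
`η(m + m′) ≤ 1/8`, lattice spacing `η` (`hsep`), `0 < η ≤ 1`, `0 ≤ β ≤ 1`. [cite: Balaban1987RG1, (3.32) p.277]
(elementary API for the third member of (3.32); our proof) -/
theorem holderB5_grad_newPot_le {η c m m' g g' β : ℝ} (hη : 0 < η) (hη1 : η ≤ 1) (hβ0 : 0 ≤ β) (hβ1 : β ≤ 1)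
    (hc : 0 ≤ c) (sameDir : κ → κ → Prop) (dist : κ → κ → ℝ) (S : Finset κ) (src tgt : κ → ι) (A h : ι → 𝔸)
    (hsep : ∀ k ∈ S, ∀ k' ∈ S, 0 < dist k k' → η ≤ dist k k')
    (hA : ∀ k ∈ S, ‖A (src k)‖ ≤ m ∧ ‖A (tgt k)‖ ≤ m) (hh : ∀ k ∈ S, ‖h (src k)‖ ≤ m' ∧ ‖h (tgt k)‖ ≤ m')
    (hgA : ∀ k ∈ S, ‖c • (A (tgt k) - A (src k))‖ ≤ g) (hgh : ∀ k ∈ S, ‖c • (h (tgt k) - h (src k))‖ ≤ g')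
    (hmg : 0 ≤ (m + m') * (g + g')) (hsmall : η * (m + m') ≤ 1 / 8) :
    holderSeminormB5 β sameDir dist S
        (fun k => c • (newPot η (A (tgt k)) (h (tgt k)) - newPot η (A (src k)) (h (src k)))) ≤
      holderSeminormB5 β sameDir dist S (fun k => c • (A (tgt k) - A (src k))) +
        holderSeminormB5 β sameDir dist S (fun k => c • (h (tgt k) - h (src k))) + 6 * (m + m') * (g + g') := by
  have hC : 0 ≤ holderSeminormB5 β sameDir dist S (fun k => c • (A (tgt k) - A (src k))) +
      holderSeminormB5 β sameDir dist S (fun k => c • (h (tgt k) - h (src k))) + 6 * (m + m') * (g + g') := by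
    have h1 := holderSeminorm_nonneg β (fun b b' => sameDir b b' ∧ dist b b' ≤ 1) dist (fun _ _ => id) S
      (fun k => c • (A (tgt k) - A (src k)))
    have h2 := holderSeminorm_nonneg β (fun b b' => sameDir b b' ∧ dist b b' ≤ 1) dist (fun _ _ => id) S
      (fun k => c • (h (tgt k) - h (src k)))
    have h3 : 0 ≤ 6 * (m + m') * (g + g') := by rw [mul_assoc]; exact mul_nonneg (by norm_num) hmg
    exact add_nonneg (add_nonneg h1 h2) h3
  unfold holderSeminormB5 at hC ⊢
  refine holderSeminorm_le hC fun k hk k' hk' hadm hpos => ?_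
  exact holder_pair_grad_newPot_le hη hη1 hβ0 hβ1 hc sameDir dist S src tgt A h hA hh hgA hgh hsmall hk hk' hadm.1
    hadm.2 hpos (hsep k hk k' hk' hpos)

/-- **(3.32), third member** («‖A‖_{1,β} < 2(α₂ + B₃O(1)Mα₀)»): if on the region `|𝐀|, |∇^η𝐀|, ‖𝐀‖_{1,β} < α₂` ((3.31))
and `|h|, |∇^ηh|, ‖h‖_{1,β} < α′` ((3.27), `α′ = B₃O(1)Mα₀`, `h = L⁻¹𝐇_{k+1}(□₀, (1/i) log V)`), the lattice has spacing `η`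
(`hsep`: distinct comparable gradient indices are `≥ η` apart), `0 < η ≤ 1`, `0 ≤ β ≤ 1`, and the α's are small —
`η(α₂ + α′) ≤ 1/8`, `6(α₂ + α′) ≤ 1` — then `‖A‖_{1,β} = ‖∇^ηA‖_β < 2(α₂ + α′)` for `A = Λ(𝐀, h)` bondwise, the Hölder
seminorm being B5 (1.109) (`LatticeNorms.holderSeminormB5`, BY NAME) of the gradient field `k ↦ c•(A(tgt k) − A(src k))`
(`c = η⁻¹ ≥ 0`).  Bound obtained: `α₂ + α′ + 6(α₂ + α′)²`, inside the printed `2(α₂ + α′)`. [cite: Balaban1987RG1, (3.32) p.277] -/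
theorem ineq332_holder {η c α₂ α' β : ℝ} (hη : 0 < η) (hη1 : η ≤ 1) (hβ0 : 0 ≤ β) (hβ1 : β ≤ 1) (hc : 0 ≤ c)
    (sameDir : κ → κ → Prop) (dist : κ → κ → ℝ) (S : Finset κ) (src tgt : κ → ι) {A h : ι → 𝔸}
    (hsep : ∀ k ∈ S, ∀ k' ∈ S, 0 < dist k k' → η ≤ dist k k')
    (hA : ∀ k ∈ S, ‖A (src k)‖ < α₂ ∧ ‖A (tgt k)‖ < α₂) (hh : ∀ k ∈ S, ‖h (src k)‖ < α' ∧ ‖h (tgt k)‖ < α')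
    (hdA : ∀ k ∈ S, ‖c • (A (tgt k) - A (src k))‖ < α₂) (hdh : ∀ k ∈ S, ‖c • (h (tgt k) - h (src k))‖ < α')
    (hHA : holderSeminormB5 β sameDir dist S (fun k => c • (A (tgt k) - A (src k))) < α₂)
    (hHh : holderSeminormB5 β sameDir dist S (fun k => c • (h (tgt k) - h (src k))) < α')
    (hsmall : η * (α₂ + α') ≤ 1 / 8) (hsmall' : 6 * (α₂ + α') ≤ 1) :
    holderSeminormB5 β sameDir dist S
        (fun k => c • (newPot η (A (tgt k)) (h (tgt k)) - newPot η (A (src k)) (h (src k)))) < 2 * (α₂ + α') := by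
  have hα₂ : 0 < α₂ := (holderSeminorm_nonneg β (fun b b' => sameDir b b' ∧ dist b b' ≤ 1) dist (fun _ _ => id) S
    (fun k => c • (A (tgt k) - A (src k)))).trans_lt hHA
  have hα' : 0 < α' := (holderSeminorm_nonneg β (fun b b' => sameDir b b' ∧ dist b b' ≤ 1) dist (fun _ _ => id) S
    (fun k => c • (h (tgt k) - h (src k)))).trans_lt hHh
  have h1 := holderB5_grad_newPot_le hη hη1 hβ0 hβ1 hc sameDir dist S src tgt A h (m := α₂) (m' := α') (g := α₂)
    (g' := α') hsep (fun k hk => ⟨(hA k hk).1.le, (hA k hk).2.le⟩) (fun k hk => ⟨(hh k hk).1.le, (hh k hk).2.le⟩)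
    (fun k hk => (hdA k hk).le) (fun k hk => (hdh k hk).le) (by positivity) hsmall
  have h6 : 6 * (α₂ + α') * (α₂ + α') ≤ 1 * (α₂ + α') := mul_le_mul_of_nonneg_right hsmall' (by positivity)
  linarith

end HolderMember


end Literature.MathematicalPhysics.QuantumFieldTheory.Balaban1983to89.B12Ineq332
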